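import Mathlib

/-!
# PneNP / ConvexRankGates — `ConvexGateBlind`: row lower bound, combinatorial core

Helpers (`--supports stmt-PneNP-10680`). Ingredients of the counting argument showing that a
non-negative measurement matrix `B` (the input part of a CONV gate) separating every `k`-clique
from every complete `(k-1)`-partite graph needs many ROWS (`ConvexRankGatesConvexGateBlindRows.lean`):
* `mono_of_handled`: if a non-negative pair weighting `W` gives the complete multipartite graph of a
  colouring `h` LESS weight than the vertex set `S`, where every pair inside `S` other than `{a, b}`
  is bichromatic, then every pair not inside `S` and at least as heavy as `{a, b}` is monochromatic;
* `card_topSet_le`: at most `r` elements have fewer than `r` other elements at least as heavy;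
* `card_colorings_agree_le`: colourings (modified by a fixed partial pattern) that make `g` PRIVATE
  vertex pairs monochromatic number at most `c^(m-g)`.
-/

namespace Summit.PneNP.PneNP.Theorems

open Finset

/-- Monochromatic pairs under a map: `s(v, v').map h` is a loop iff `h v = h v'`. [folklore] -/
theorem sym2_map_mk_isDiag_iff {α β : Type*} (h : α → β) (v v' : α) :
    (Sym2.map h s(v, v')).IsDiag ↔ h v = h v' := by
  rw [Sym2.map_mk, Sym2.mk_isDiag_iff]

/-- **Heavy outside edges are monochromatic.** Let `W ≥ 0` weight the non-loop pairs of `Fin m`,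
`S` a vertex set containing `a ≠ b`, and `h` a colouring under which every pair inside `S` other
than `{a, b}` is bichromatic. If the bichromatic pairs weigh LESS than the pairs inside `S`, then
every non-loop pair `f` not inside `S` with `W {a,b} ≤ W f` is monochromatic (otherwise the
bichromatic pairs `(inside S) \ {a,b} ∪ {f}` already weigh at least as much as `S`). [folklore] -/
theorem mono_of_handled {m c : ℕ} (W : Sym2 (Fin m) → ℝ) (hW : ∀ e, 0 ≤ W e) (S : Finset (Fin m))
    (h : Fin m → Fin c) (a b : Fin m) (hab : a ≠ b) (ha : a ∈ S) (hb : b ∈ S)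
    (hrain : ∀ v ∈ S, ∀ v' ∈ S, v ≠ v' → s(v, v') ≠ s(a, b) → h v ≠ h v')
    (hlt : ∑ e ∈ univ.filter (fun e : Sym2 (Fin m) => ¬ e.IsDiag),
        (if (e.map h).IsDiag then 0 else W e) <
      ∑ e ∈ univ.filter (fun e : Sym2 (Fin m) => ¬ e.IsDiag),
        (if (∀ v ∈ e, v ∈ S) then W e else 0))
    (f : Sym2 (Fin m)) (hf : ¬ f.IsDiag) (hfS : ¬ (∀ v ∈ f, v ∈ S)) (hwf : W s(a, b) ≤ W f) :
    (f.map h).IsDiag := by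
  classical
  by_contra hbich
  set Ed := univ.filter (fun e : Sym2 (Fin m) => ¬ e.IsDiag) with hEd
  set I := Ed.filter (fun e => ∀ v ∈ e, v ∈ S) with hI
  have hab_mem : s(a, b) ∈ I := by
    simp only [hI, hEd, Finset.mem_filter, Finset.mem_univ, true_and, Sym2.mk_isDiag_iff,
      Sym2.mem_iff, forall_eq_or_imp, forall_eq]
    exact ⟨hab, ha, hb⟩
  have hfI : f ∉ I.erase s(a, b) := fun hf' =>
    hfS (Finset.mem_filter.1 (Finset.mem_of_mem_erase hf')).2
  set D := insert f (I.erase s(a, b)) with hD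
  -- every pair of `D` is bichromatic and not a loop
  have hDsub : D ⊆ Ed.filter (fun e => ¬ (e.map h).IsDiag) := by
    intro e he
    rw [hD, Finset.mem_insert] at he
    rcases he with rfl | he
    · exact Finset.mem_filter.2 ⟨Finset.mem_filter.2 ⟨Finset.mem_univ _, hf⟩, hbich⟩
    · have hne : e ≠ s(a, b) := Finset.ne_of_mem_erase he
      have heI := Finset.mem_of_mem_erase he
      have heEd : e ∈ Ed := (Finset.mem_filter.1 heI).1
      have heS : ∀ v ∈ e, v ∈ S := (Finset.mem_filter.1 heI).2
      refine Finset.mem_filter.2 ⟨heEd, ?_⟩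
      have hed : ¬ e.IsDiag := (Finset.mem_filter.1 heEd).2
      induction e using Sym2.ind with
      | _ v v' =>
        rw [sym2_map_mk_isDiag_iff]
        rw [Sym2.mk_isDiag_iff] at hed
        exact hrain v (heS v (Sym2.mem_mk_left _ _)) v' (heS v' (Sym2.mem_mk_right _ _)) hed hne
  -- compare the sums
  have h1 : ∑ e ∈ D, W e ≤ ∑ e ∈ Ed, (if (e.map h).IsDiag then 0 else W e) := by
    calc ∑ e ∈ D, W e ≤ ∑ e ∈ Ed.filter (fun e => ¬ (e.map h).IsDiag), W e :=
          Finset.sum_le_sum_of_subset_of_nonneg hDsub (fun e _ _ => hW e)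
      _ = ∑ e ∈ Ed, (if (e.map h).IsDiag then 0 else W e) := by
          rw [Finset.sum_filter]
          refine Finset.sum_congr rfl fun e _ => ?_
          split_ifs <;> rfl
  have h2 : ∑ e ∈ Ed, (if (∀ v ∈ e, v ∈ S) then W e else 0) = ∑ e ∈ I, W e :=
    (Finset.sum_filter (fun e : Sym2 (Fin m) => ∀ v ∈ e, v ∈ S) W).symm
  have h3 : ∑ e ∈ I, W e = W s(a, b) + ∑ e ∈ I.erase s(a, b), W e :=
    (Finset.add_sum_erase I W hab_mem).symm
  have h4 : ∑ e ∈ D, W e = W f + ∑ e ∈ I.erase s(a, b), W e := Finset.sum_insert hfI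
  linarith

/-- **Few edges are near the top.** For a real weighting `w` of a finite set `s` and `r : ℕ`, at
most `r` elements `e ∈ s` have fewer than `r` OTHER elements of `s` of weight `≥ w e` (the lightest
such element would see all the others above it). [folklore] -/
theorem card_topSet_le {E : Type*} [DecidableEq E] (s : Finset E) (w : E → ℝ) (r : ℕ) :
    (s.filter fun e => (s.filter fun f => f ≠ e ∧ w e ≤ w f).card < r).card ≤ r := by
  set T := s.filter fun e => (s.filter fun f => f ≠ e ∧ w e ≤ w f).card < r with hT
  by_contra hlt
  push Not at hlt
  have hne : T.Nonempty := Finset.card_pos.1 (by omega)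
  obtain ⟨e, heT, hmin⟩ := T.exists_min_image w hne
  have hsub : T.erase e ⊆ s.filter fun f => f ≠ e ∧ w e ≤ w f := by
    intro f hf
    exact Finset.mem_filter.2 ⟨(Finset.mem_filter.1 (Finset.mem_of_mem_erase hf)).1,
      Finset.ne_of_mem_erase hf, hmin f (Finset.mem_of_mem_erase hf)⟩
  have h1 := Finset.card_le_card hsub
  have h2 : (T.erase e).card = T.card - 1 := Finset.card_erase_of_mem heT
  have h3 := (Finset.mem_filter.1 heT).2
  omega

/-- **Private pairs cost a colour each.** Fix a partial pattern `pat : Fin m → Option (Fin c)`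
(forced colours) and `g` vertex pairs `(uⱼ, xⱼ)` with the `uⱼ` distinct, unforced
(`pat uⱼ = none`) and private (`uⱼ ≠ xₗ` for all `j, l`). Then at most `c^(m-g)` colourings
`hout : Fin m → Fin c` make every pair monochromatic for the patterned colouring
`v ↦ (pat v).getD (hout v)`: such a colouring is determined by its values off `{uⱼ}`. [folklore] -/
theorem card_colorings_agree_le {m c g : ℕ} (pat : Fin m → Option (Fin c)) (u x : Fin g → Fin m)
    (hu : Function.Injective u) (hpat : ∀ j, pat (u j) = none) (hpriv : ∀ j l, u j ≠ x l) :
    (univ.filter fun hout : Fin m → Fin c =>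
      ∀ j, (pat (u j)).getD (hout (u j)) = (pat (x j)).getD (hout (x j))).card ≤ c ^ (m - g) := by
  classical
  set M := univ.filter fun hout : Fin m → Fin c =>
      ∀ j, (pat (u j)).getD (hout (u j)) = (pat (x j)).getD (hout (x j)) with hM
  -- restriction to the complement of the private vertices is injective on `M`
  set R : (Fin m → Fin c) → ({v : Fin m // v ∉ Set.range u} → Fin c) := fun hout v => hout v.1
    with hR
  have hinj : Set.InjOn R M := by
    intro h₁ hh₁ h₂ hh₂ hR12
    have hM1 := (Finset.mem_filter.1 (Finset.mem_coe.1 hh₁)).2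
    have hM2 := (Finset.mem_filter.1 (Finset.mem_coe.1 hh₂)).2
    have hoff : ∀ v, v ∉ Set.range u → h₁ v = h₂ v := fun v hv => congrFun hR12 ⟨v, hv⟩
    funext v
    by_cases hv : v ∈ Set.range u
    · obtain ⟨j, rfl⟩ := hv
      have hx : x j ∉ Set.range u := by
        rintro ⟨l, hl⟩
        exact hpriv l j hl
      have e1 := hM1 j
      have e2 := hM2 j
      rw [hpat j, Option.getD_none] at e1 e2
      rw [e1, e2]
      -- the forced-or-free colour of `x j` agrees
      cases hpx : pat (x j) with
      | none => simp only [Option.getD_none]; exact hoff _ hx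
      | some col => rfl
    · exact hoff v hv
  have hcard : Fintype.card ({v : Fin m // v ∉ Set.range u} → Fin c) = c ^ (m - g) := by
    rw [Fintype.card_fun, Fintype.card_fin]
    congr 1
    have h1 : Fintype.card {v : Fin m // v ∉ Set.range u} =
        Fintype.card (Fin m) - Fintype.card (Set.range u) := by
      rw [← Fintype.card_subtype_compl]
    rw [h1, Fintype.card_fin, Set.card_range_of_injective hu, Fintype.card_fin]
  calc M.card ≤ (univ : Finset ({v : Fin m // v ∉ Set.range u} → Fin c)).card :=
        Finset.card_le_card_of_injOn R (fun _ _ => Finset.mem_univ _) hinj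
    _ = c ^ (m - g) := by rw [Finset.card_univ, hcard]

end Summit.PneNP.PneNP.Theorems
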